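import Mathlib
import HarnessLib
import Summits.HubbardSuperconductivity.HubbardSuperconductivity.Theorems.KLProgrammeC4aCausticTouchConvexity

/-!
# Route `KLProgramme` — crux C4a, S3 brick (B4) «(B4)-UMK1», «(M2)-DISPATCH» part 1: the SIGN PAIR of a strongly convex continuous caustic offset on a fixed
# window — zeros located by monotonicity/IVT (no implicit function), the product floor `(κ/2)|ϑ−e₁||ϑ−e₂| ≤ |δ₀(ϑ)|` on the WHOLE window in every configuration,
# and the strong-convexity modulus in closed form (Schur complement of the Hessian)

Cell `gate-hubbard-kl`, seat hubbard-kl-k3c3-p3 (g29; row «implicit-function / monotonicity route for μ(n)»).  Located brick for the (C)-closer lane hubbard-kl-c4a-1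
(stub (C) `stub_twoLeg_curvature` of `KLRegimeEngineV17F2`, stmt-HubbardSuperconductivity-20437), memo HOME/hubbard-kl-k3c3-p3/U1-CAUSTIC-SUP.md §7 REMAINING (M2)
(«joint strong convexity of the partner-band family near an antipodal-umklapp configuration + LOCALISATION OF THE ZERO PAIR `c₁ ≤ c₂` of `δ₀(·;θ)` for θ near θ₀ —
two zeros / double / none»).  `…C4aCausticTouchConvexity` derives the product floor FROM given zeros; `…C4aCausticPairLayer(Remainder)` is keyed to them.  This file
makes the zero set INTERNAL, so that no caller ever locates a zero or decides on which side of the touch a base angle lies: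
* §1 floors WITHOUT zeros: `sq_le_sub_of_convexOn_isMinOn` (`(κ/2)(ϑ − c)² ≤ m ϑ − m c` at a constrained minimiser), `le_neg_mul_of_convexOn_nonpos_pair` (two points with
  `m ≤ 0` ⟹ `m ϑ ≤ −(κ/2)(ϑ−e₁)(e₂−ϑ)` between them — an end of the post-caustic gap may lie OUTSIDE the window), `mul_le_of_convexOn_zero_right/left` (a zero and a
  nonpositive point ⟹ the outside product floor);
* §2 **`exists_signPair_of_convexOn_sub_sq`**: `m` continuous on `[α,β]` with `m − (κ/2)(·)²` convex, `0 < κ` ⟹ a SIGN PAIR `α ≤ e₁ ≤ e₂ ≤ β` with `m > 0` and the outside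
  floors off `[e₁,e₂]`, `m < 0` and the inside ceiling on `(e₁,e₂)`, and `(κ/2)|ϑ−e₁||ϑ−e₂| ≤ |m ϑ|` on the whole window (`{m ≤ 0}` is a compact interval by convexity of
  `m` and continuity; an end of it interior to the window is a zero by the intermediate value theorem; if `{m ≤ 0} = ∅` the pair degenerates to the minimiser);
* §3 `sq_mul_le_quadForm_of_schur` / `le_schur_of_sq_mul_le_quadForm`: the modulus of `convexOn_sub_sq_of_line_deriv2` in closed form — `κu² ≤ au² + 2buv + cv²` for all
  `(u,v)` iff (`c > 0`) `κ ≤ a − b²/c`, the Schur complement (= memo §3's `δ₀″ = g_ϑϑ − g_ϑφ²/g_φφ = κ²Q_p/2 + λQ′`): the one model-side input left in (M2) is this floor for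
  the partner-band Hessian on a neighbourhood of the configuration.
Consumer: `…C4aCausticWindowDispatch` (the pair layer on a fixed window, laws routed by the SIGN of the offset).  Pure real/convex analysis; nothing about the model;
nothing asserts (C), K3 or superconductivity.
References: Salmhofer 1999 §4.5.3 [cite: Salmhofer1999]; FST II CPAM 51 (1998) §3 [cite: FeldmanSalmhoferTrubowitz1998].
-/

noncomputable section

namespace Summit.HubbardSuperconductivity.HubbardSuperconductivity.Theorems.C4a

set_option linter.dupNamespace false -- summit = problem name (single-conjunct summit), D-0017

open Real Set

/-! ## §1 Floors without zeros -/

/-- **FLOOR AT A CONSTRAINED MINIMISER.**  `ϑ ↦ m ϑ − (κ/2)ϑ²` convex on `I`, `0 < κ`, `c ∈ I` a minimiser of `m` on `I`.  THEN `(κ/2)(ϑ − c)² ≤ m ϑ − m c` on `I`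
(no interiority, no derivative; `sq_le_of_convexOn_zero_min` applied to `m − m c`). -/
theorem sq_le_sub_of_convexOn_isMinOn {m : ℝ → ℝ} {I : Set ℝ} {κ c : ℝ}
    (hφ : ConvexOn ℝ I (fun ϑ => m ϑ - κ / 2 * ϑ ^ 2)) (hκ : 0 < κ) (hc : c ∈ I) (hmin : IsMinOn m I c)
    {ϑ : ℝ} (hϑ : ϑ ∈ I) : κ / 2 * (ϑ - c) ^ 2 ≤ m ϑ - m c := by
  have hφ' : ConvexOn ℝ I (fun ϑ => (m ϑ - m c) - κ / 2 * ϑ ^ 2) := by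
    have h := hφ.add (convexOn_const (-m c) hφ.1)
    have he : (fun ϑ => (m ϑ - m c) - κ / 2 * ϑ ^ 2) = (fun ϑ => m ϑ - κ / 2 * ϑ ^ 2) + fun _ => -m c := by
      funext ϑ; simp only [Pi.add_apply]; ring
    rw [he]; exact h
  exact sq_le_of_convexOn_zero_min hφ' hκ hc (by simp) (fun x hx => sub_nonneg.2 (isMinOn_iff.1 hmin x hx)) hϑ

/-- **TWO NONPOSITIVE POINTS: THE INSIDE CEILING.**  `ϑ ↦ m ϑ − (κ/2)ϑ²` convex on `I`, `e₁ < e₂` in `I`, `m e₁ ≤ 0`, `m e₂ ≤ 0`.  THEN for `e₁ ≤ ϑ ≤ e₂`: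
`m ϑ ≤ −(κ/2)(ϑ − e₁)(e₂ − ϑ)` (for `0 < κ`: strictly negative strictly inside). -/
theorem le_neg_mul_of_convexOn_nonpos_pair {m : ℝ → ℝ} {I : Set ℝ} {κ e₁ e₂ : ℝ}
    (hφ : ConvexOn ℝ I (fun ϑ => m ϑ - κ / 2 * ϑ ^ 2)) (he₁ : e₁ ∈ I) (he₂ : e₂ ∈ I) (hlt : e₁ < e₂)
    (h₁ : m e₁ ≤ 0) (h₂ : m e₂ ≤ 0) {ϑ : ℝ} (hϑ1 : e₁ ≤ ϑ) (hϑ2 : ϑ ≤ e₂) :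
    m ϑ ≤ -(κ / 2 * (ϑ - e₁) * (e₂ - ϑ)) := by
  have hd : 0 < e₂ - e₁ := sub_pos.2 hlt
  set a : ℝ := (e₂ - ϑ) / (e₂ - e₁) with ha
  set b : ℝ := (ϑ - e₁) / (e₂ - e₁) with hb
  have ha0 : 0 ≤ a := by rw [ha]; exact div_nonneg (by linarith) hd.le
  have hb0 : 0 ≤ b := by rw [hb]; exact div_nonneg (by linarith) hd.le
  have hab : a + b = 1 := by rw [ha, hb]; field_simp; ring
  have hcomb : a * e₁ + b * e₂ = ϑ := by rw [ha, hb]; field_simp; ring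
  have hj := hφ.2 he₁ he₂ ha0 hb0 hab
  simp only [smul_eq_mul, hcomb] at hj
  have h5 : a * (-(κ / 2) * e₁ ^ 2) + b * (-(κ / 2) * e₂ ^ 2) + κ / 2 * ϑ ^ 2 = -(κ / 2 * (ϑ - e₁) * (e₂ - ϑ)) := by
    rw [ha, hb]; field_simp; ring
  have h6 : a * m e₁ ≤ 0 := mul_nonpos_of_nonneg_of_nonpos ha0 h₁
  have h7 : b * m e₂ ≤ 0 := mul_nonpos_of_nonneg_of_nonpos hb0 h₂
  have h8 : m ϑ = (m ϑ - κ / 2 * ϑ ^ 2) + κ / 2 * ϑ ^ 2 := by ring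
  nlinarith [hj, h5, h6, h7, h8]

/-- **A ZERO AND A NONPOSITIVE POINT: THE OUTSIDE FLOOR (right).**  `ϑ ↦ m ϑ − (κ/2)ϑ²` convex on `I`, `e₁ < e₂`, `e₁ ∈ I`, `m e₁ ≤ 0`, `m e₂ = 0`.  THEN for
`ϑ ∈ I` with `e₂ ≤ ϑ`: `(κ/2)(ϑ − e₁)(ϑ − e₂) ≤ m ϑ`. -/
theorem mul_le_of_convexOn_zero_right {m : ℝ → ℝ} {I : Set ℝ} {κ e₁ e₂ : ℝ}
    (hφ : ConvexOn ℝ I (fun ϑ => m ϑ - κ / 2 * ϑ ^ 2)) (he₁ : e₁ ∈ I) (hlt : e₁ < e₂)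
    (h₁ : m e₁ ≤ 0) (h₂ : m e₂ = 0) {ϑ : ℝ} (hϑ : ϑ ∈ I) (hϑ2 : e₂ ≤ ϑ) :
    κ / 2 * (ϑ - e₁) * (ϑ - e₂) ≤ m ϑ := by
  rcases eq_or_lt_of_le hϑ2 with heq | hgt
  · subst heq; simp [h₂]
  have hd : 0 < ϑ - e₁ := by linarith
  set a : ℝ := (ϑ - e₂) / (ϑ - e₁) with ha
  set b : ℝ := (e₂ - e₁) / (ϑ - e₁) with hb
  have ha0 : 0 ≤ a := by rw [ha]; exact div_nonneg (by linarith) hd.le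
  have hb0 : 0 ≤ b := by rw [hb]; exact div_nonneg (by linarith) hd.le
  have hbpos : 0 < b := by rw [hb]; exact div_pos (by linarith) hd
  have hab : a + b = 1 := by rw [ha, hb]; field_simp; ring
  have hcomb : a * e₁ + b * ϑ = e₂ := by rw [ha, hb]; field_simp; ring
  have hj := hφ.2 he₁ hϑ ha0 hb0 hab
  simp only [smul_eq_mul, hcomb, h₂] at hj
  -- `b · m ϑ ≥ −a m e₁ + (κ/2)(a e₁² + b ϑ² − e₂²)` and `a e₁² + b ϑ² − e₂² = (ϑ − e₂)(e₂ − e₁)`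
  have h5 : b * (κ / 2 * (ϑ - e₁) * (ϑ - e₂)) = κ / 2 * (b * ϑ ^ 2 + a * e₁ ^ 2 - e₂ ^ 2) := by
    rw [ha, hb]; field_simp; ring
  have h6 : a * m e₁ ≤ 0 := mul_nonpos_of_nonneg_of_nonpos ha0 h₁
  have h7 : b * (κ / 2 * (ϑ - e₁) * (ϑ - e₂)) ≤ b * m ϑ := by nlinarith [hj, h5, h6]
  exact le_of_mul_le_mul_left h7 hbpos

/-- **A ZERO AND A NONPOSITIVE POINT: THE OUTSIDE FLOOR (left).**  `ϑ ↦ m ϑ − (κ/2)ϑ²` convex on `I`, `e₁ < e₂`, `e₂ ∈ I`, `m e₁ = 0`, `m e₂ ≤ 0`.  THEN for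
`ϑ ∈ I` with `ϑ ≤ e₁`: `(κ/2)(e₁ − ϑ)(e₂ − ϑ) ≤ m ϑ`. -/
theorem mul_le_of_convexOn_zero_left {m : ℝ → ℝ} {I : Set ℝ} {κ e₁ e₂ : ℝ}
    (hφ : ConvexOn ℝ I (fun ϑ => m ϑ - κ / 2 * ϑ ^ 2)) (he₂ : e₂ ∈ I) (hlt : e₁ < e₂)
    (h₁ : m e₁ = 0) (h₂ : m e₂ ≤ 0) {ϑ : ℝ} (hϑ : ϑ ∈ I) (hϑ1 : ϑ ≤ e₁) :
    κ / 2 * (e₁ - ϑ) * (e₂ - ϑ) ≤ m ϑ := by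
  rcases eq_or_lt_of_le hϑ1 with heq | hgt
  · subst heq; simp [h₁]
  have hd : 0 < e₂ - ϑ := by linarith
  set a : ℝ := (e₂ - e₁) / (e₂ - ϑ) with ha
  set b : ℝ := (e₁ - ϑ) / (e₂ - ϑ) with hb
  have ha0 : 0 ≤ a := by rw [ha]; exact div_nonneg (by linarith) hd.le
  have hb0 : 0 ≤ b := by rw [hb]; exact div_nonneg (by linarith) hd.le
  have hapos : 0 < a := by rw [ha]; exact div_pos (by linarith) hd
  have hab : a + b = 1 := by rw [ha, hb]; field_simp; ring
  have hcomb : a * ϑ + b * e₂ = e₁ := by rw [ha, hb]; field_simp; ring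
  have hj := hφ.2 hϑ he₂ ha0 hb0 hab
  simp only [smul_eq_mul, hcomb, h₁] at hj
  have h5 : a * (κ / 2 * (e₁ - ϑ) * (e₂ - ϑ)) = κ / 2 * (a * ϑ ^ 2 + b * e₂ ^ 2 - e₁ ^ 2) := by
    rw [ha, hb]; field_simp; ring
  have h6 : b * m e₂ ≤ 0 := mul_nonpos_of_nonneg_of_nonpos hb0 h₂
  have h7 : a * (κ / 2 * (e₁ - ϑ) * (e₂ - ϑ)) ≤ a * m ϑ := by nlinarith [hj, h5, h6]
  exact le_of_mul_le_mul_left h7 hapos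

/-! ## §2 The sign pair of a strongly convex continuous offset on a window -/

/-- **THE SIGN PAIR** (zero-set trichotomy made uniform).  `α ≤ β`, `0 < κ`, `m` continuous on `[α,β]` with `ϑ ↦ m ϑ − (κ/2)ϑ²` convex there.  THEN there are
`α ≤ e₁ ≤ e₂ ≤ β` such that: (i) left of `e₁` (in the window) `0 < m` and `(κ/2)(e₁−ϑ)(e₂−ϑ) ≤ m ϑ`; (ii) right of `e₂` `0 < m` and `(κ/2)(ϑ−e₁)(ϑ−e₂) ≤ m ϑ`;
(iii) on `(e₁,e₂)` `m < 0` and `m ϑ ≤ −(κ/2)(ϑ−e₁)(e₂−ϑ)`; (iv) `(κ/2)|ϑ−e₁||ϑ−e₂| ≤ |m ϑ|` on the whole window (the `hm` of the pair layer with `b = κ/2`).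
The three configurations of memo §3 — no zero (`e₁ = e₂ =` the minimiser, `m > 0` off it), the pre-side double zero, a (weakly) transversal pair, also with an end of the
post-caustic gap outside the window (`e₁ = α` or `e₂ = β`) — are all instances; the caller never decides which. -/
theorem exists_signPair_of_convexOn_sub_sq {m : ℝ → ℝ} {α β κ : ℝ} (hαβ : α ≤ β) (hκ : 0 < κ)
    (hφ : ConvexOn ℝ (Icc α β) (fun ϑ => m ϑ - κ / 2 * ϑ ^ 2)) (hcont : ContinuousOn m (Icc α β)) :
    ∃ e₁ e₂ : ℝ, α ≤ e₁ ∧ e₁ ≤ e₂ ∧ e₂ ≤ β ∧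
      (∀ ϑ ∈ Icc α β, ϑ < e₁ → 0 < m ϑ ∧ κ / 2 * (e₁ - ϑ) * (e₂ - ϑ) ≤ m ϑ) ∧
      (∀ ϑ ∈ Icc α β, e₂ < ϑ → 0 < m ϑ ∧ κ / 2 * (ϑ - e₁) * (ϑ - e₂) ≤ m ϑ) ∧
      (∀ ϑ ∈ Ioo e₁ e₂, m ϑ < 0 ∧ m ϑ ≤ -(κ / 2 * (ϑ - e₁) * (e₂ - ϑ))) ∧
      (∀ ϑ ∈ Icc α β, κ / 2 * |ϑ - e₁| * |ϑ - e₂| ≤ |m ϑ|) := by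
  obtain ⟨c, hcI, hcmin⟩ := isCompact_Icc.exists_isMinOn (nonempty_Icc.2 hαβ) hcont
  have hmin' : ∀ x ∈ Icc α β, m c ≤ m x := fun x hx => isMinOn_iff.1 hcmin x hx
  by_cases hpos : 0 < m c
  · -- no zero: the sign pair degenerates to the minimiser
    have hfl : ∀ ϑ ∈ Icc α β, κ / 2 * (ϑ - c) ^ 2 ≤ m ϑ := fun ϑ hϑ => by
      have h := sq_le_sub_of_convexOn_isMinOn hφ hκ hcI hcmin hϑ
      linarith [hmin' c hcI]
    refine ⟨c, c, hcI.1, le_rfl, hcI.2, fun ϑ hϑ _ => ⟨lt_of_lt_of_le hpos (hmin' ϑ hϑ), ?_⟩,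
      fun ϑ hϑ _ => ⟨lt_of_lt_of_le hpos (hmin' ϑ hϑ), ?_⟩, fun ϑ hϑ => ?_, fun ϑ hϑ => ?_⟩
    · have := hfl ϑ hϑ; nlinarith
    · have := hfl ϑ hϑ; nlinarith
    · exact absurd hϑ (by simp : ϑ ∉ Ioo c c)
    · rw [mul_assoc, ← abs_mul, ← pow_two, abs_of_nonneg (sq_nonneg _)]
      exact (hfl ϑ hϑ).trans (le_abs_self _)
  · push Not at hpos
    -- the sublevel set `S = {m ≤ 0}` is a nonempty compact interval `[e₁, e₂]`
    set S : Set ℝ := Icc α β ∩ m ⁻¹' Iic 0 with hS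
    have hcS : c ∈ S := ⟨hcI, hpos⟩
    have hSne : S.Nonempty := ⟨c, hcS⟩
    have hSclosed : IsClosed S := hcont.preimage_isClosed_of_isClosed isClosed_Icc isClosed_Iic
    have hScpt : IsCompact S := isCompact_Icc.of_isClosed_subset hSclosed inter_subset_left
    have hpar : ConvexOn ℝ (Icc α β) (fun ϑ : ℝ => κ / 2 * ϑ ^ 2) := by
      have h := (Even.convexOn_pow (𝕜 := ℝ) (n := 2) even_two).subset (subset_univ (Icc α β)) (convex_Icc α β)
      exact h.smul (by positivity : (0 : ℝ) ≤ κ / 2)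
    have hmconv : ConvexOn ℝ (Icc α β) m := by
      have h := hφ.add hpar
      have he : ((fun ϑ => m ϑ - κ / 2 * ϑ ^ 2) + fun ϑ : ℝ => κ / 2 * ϑ ^ 2) = m := by
        funext ϑ; simp only [Pi.add_apply]; ring
      rw [he] at h; exact h
    have hSconv : Convex ℝ S := by
      have h := hmconv.convex_le 0
      have he : {x ∈ Icc α β | m x ≤ 0} = S := by ext x; simp [hS]
      rw [he] at h; exact h
    set e₁ : ℝ := sInf S with he₁
    set e₂ : ℝ := sSup S with he₂
    have he₁S : e₁ ∈ S := hScpt.sInf_mem hSne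
    have he₂S : e₂ ∈ S := hScpt.sSup_mem hSne
    have hlo : ∀ ϑ ∈ S, e₁ ≤ ϑ := fun ϑ h => csInf_le hScpt.bddBelow h
    have hhi : ∀ ϑ ∈ S, ϑ ≤ e₂ := fun ϑ h => le_csSup hScpt.bddAbove h
    have hsub : Icc e₁ e₂ ⊆ S := hSconv.ordConnected.out he₁S he₂S
    have h12 : e₁ ≤ e₂ := (hlo c hcS).trans (hhi c hcS)
    have hm₁ : m e₁ ≤ 0 := he₁S.2
    have hm₂ : m e₂ ≤ 0 := he₂S.2
    -- outside `S`: `0 < m`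
    have hout : ∀ ϑ ∈ Icc α β, ϑ < e₁ ∨ e₂ < ϑ → 0 < m ϑ := fun ϑ hϑ hside => by
      by_contra hle
      push Not at hle
      have hϑS : ϑ ∈ S := ⟨hϑ, hle⟩
      rcases hside with h | h
      · exact absurd (hlo ϑ hϑS) (not_le.2 h)
      · exact absurd (hhi ϑ hϑS) (not_le.2 h)
    -- an end of `S` interior to the window is a zero (intermediate value theorem)
    have hz₁ : α < e₁ → m e₁ = 0 := fun hα => by
      have hαpos : 0 < m α := hout α (left_mem_Icc.2 hαβ) (Or.inl hα)
      have hcont' : ContinuousOn m (Icc α e₁) := hcont.mono (Icc_subset_Icc le_rfl he₁S.1.2)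
      have hmem : (0 : ℝ) ∈ Icc (m e₁) (m α) := ⟨hm₁, hαpos.le⟩
      obtain ⟨z, hz, hz0⟩ := intermediate_value_Icc' hα.le hcont' hmem
      have hzS : z ∈ S := ⟨⟨hz.1, hz.2.trans he₁S.1.2⟩, le_of_eq hz0⟩
      have hz1 : z = e₁ := le_antisymm hz.2 (hlo z hzS)
      rw [← hz1]; exact hz0
    have hz₂ : e₂ < β → m e₂ = 0 := fun hβ => by
      have hβpos : 0 < m β := hout β (right_mem_Icc.2 hαβ) (Or.inr hβ)
      have hcont' : ContinuousOn m (Icc e₂ β) := hcont.mono (Icc_subset_Icc he₂S.1.1 le_rfl)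
      have hmem : (0 : ℝ) ∈ Icc (m e₂) (m β) := ⟨hm₂, hβpos.le⟩
      obtain ⟨z, hz, hz0⟩ := intermediate_value_Icc he₂S.1.2 hcont' hmem
      have hzS : z ∈ S := ⟨⟨he₂S.1.1.trans hz.1, hz.2⟩, le_of_eq hz0⟩
      have hz1 : z = e₂ := le_antisymm (hhi z hzS) hz.1
      rw [← hz1]; exact hz0
    -- the floors
    have hleft : ∀ ϑ ∈ Icc α β, ϑ < e₁ → 0 < m ϑ ∧ κ / 2 * (e₁ - ϑ) * (e₂ - ϑ) ≤ m ϑ := fun ϑ hϑ h => by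
      refine ⟨hout ϑ hϑ (Or.inl h), ?_⟩
      have hα : α < e₁ := lt_of_le_of_lt hϑ.1 h
      rcases eq_or_lt_of_le h12 with heq | hlt
      · -- `e₁ = e₂` is then a zero and a minimum... floor from the minimiser `c = e₁`
        have hc1 : c = e₁ := le_antisymm (by rw [← heq] at hhi; exact hhi c hcS) (hlo c hcS)
        have h0 : m c = 0 := by rw [hc1]; exact hz₁ hα
        have hfl := sq_le_sub_of_convexOn_isMinOn hφ hκ hcI hcmin hϑ
        rw [h0, sub_zero, hc1] at hfl
        rw [← heq]; nlinarith [hfl]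
      · exact mul_le_of_convexOn_zero_left hφ he₂S.1 hlt (hz₁ hα) hm₂ hϑ h.le
    have hright : ∀ ϑ ∈ Icc α β, e₂ < ϑ → 0 < m ϑ ∧ κ / 2 * (ϑ - e₁) * (ϑ - e₂) ≤ m ϑ := fun ϑ hϑ h => by
      refine ⟨hout ϑ hϑ (Or.inr h), ?_⟩
      have hβ : e₂ < β := lt_of_lt_of_le h hϑ.2
      rcases eq_or_lt_of_le h12 with heq | hlt
      · have hc2 : c = e₂ := le_antisymm (hhi c hcS) (by rw [heq] at hlo; exact hlo c hcS)
        have h0 : m c = 0 := by rw [hc2]; exact hz₂ hβ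
        have hfl := sq_le_sub_of_convexOn_isMinOn hφ hκ hcI hcmin hϑ
        rw [h0, sub_zero, hc2] at hfl
        rw [heq]; nlinarith [hfl]
      · exact mul_le_of_convexOn_zero_right hφ he₁S.1 hlt hm₁ (hz₂ hβ) hϑ h.le
    have hin : ∀ ϑ ∈ Ioo e₁ e₂, m ϑ < 0 ∧ m ϑ ≤ -(κ / 2 * (ϑ - e₁) * (e₂ - ϑ)) := fun ϑ hϑ => by
      have hlt : e₁ < e₂ := hϑ.1.trans hϑ.2
      have hc := le_neg_mul_of_convexOn_nonpos_pair hφ he₁S.1 he₂S.1 hlt hm₁ hm₂ hϑ.1.le hϑ.2.le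
      refine ⟨lt_of_le_of_lt hc ?_, hc⟩
      have : 0 < κ / 2 * (ϑ - e₁) * (e₂ - ϑ) := by
        have h1 : 0 < ϑ - e₁ := sub_pos.2 hϑ.1
        have h2 : 0 < e₂ - ϑ := sub_pos.2 hϑ.2
        positivity
      linarith
    refine ⟨e₁, e₂, he₁S.1.1, h12, he₂S.1.2, hleft, hright, hin, fun ϑ hϑ => ?_⟩
    -- (iv) the product floor everywhere, by position
    rcases lt_or_ge ϑ e₁ with h1 | h1
    · have h := (hleft ϑ hϑ h1).2
      rw [abs_of_neg (by linarith : ϑ - e₁ < 0), abs_of_neg (by linarith : ϑ - e₂ < 0)]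
      calc κ / 2 * -(ϑ - e₁) * -(ϑ - e₂) = κ / 2 * (e₁ - ϑ) * (e₂ - ϑ) := by ring
        _ ≤ m ϑ := h
        _ ≤ |m ϑ| := le_abs_self _
    rcases lt_or_ge e₂ ϑ with h2 | h2
    · have h := (hright ϑ hϑ h2).2
      rw [abs_of_nonneg (by linarith : 0 ≤ ϑ - e₁), abs_of_pos (by linarith : 0 < ϑ - e₂)]
      exact h.trans (le_abs_self _)
    -- inside `[e₁, e₂]`
    rcases eq_or_lt_of_le h1 with h1e | h1l
    · rw [← h1e]; simp
    rcases eq_or_lt_of_le h2 with h2e | h2l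
    · rw [h2e]; simp
    have h := (hin ϑ ⟨h1l, h2l⟩).2
    rw [abs_of_pos (by linarith : 0 < ϑ - e₁), abs_of_neg (by linarith : ϑ - e₂ < 0)]
    calc κ / 2 * (ϑ - e₁) * -(ϑ - e₂) = κ / 2 * (ϑ - e₁) * (e₂ - ϑ) := by ring
      _ ≤ -m ϑ := by linarith [h]
      _ ≤ |m ϑ| := neg_le_abs _

/-! ## §3 The modulus in closed form: the Schur complement of the Hessian -/

/-- **SCHUR FLOOR OF A BINARY QUADRATIC FORM.**  `0 < c`, `κ ≤ a − b²/c` ⟹ `κu² ≤ au² + 2buv + cv²` for all `u, v` — with `(a, b, c) = (g_ϑϑ, g_ϑφ, g_φφ)` the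
Hessian of the partner-band family `g(ϑ,φ)` along a segment of direction `(u,v)`, this is the directional floor `κ(q₁−p₁)² ≤ ∂ₛ²g` of
`convexOn_sub_sq_of_line_deriv2`; the best modulus is the Schur complement `a − b²/c` (= memo §3's `δ₀″ = g_ϑϑ − g_ϑφ²/g_φφ = κ²Q_p/2 + λQ′`). -/
theorem sq_mul_le_quadForm_of_schur {a b c κ u v : ℝ} (hc : 0 < c) (hκ : κ ≤ a - b ^ 2 / c) :
    κ * u ^ 2 ≤ a * u ^ 2 + 2 * b * u * v + c * v ^ 2 := by
  have h1 : κ * u ^ 2 ≤ (a - b ^ 2 / c) * u ^ 2 := mul_le_mul_of_nonneg_right hκ (sq_nonneg u)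
  have h2 : a * u ^ 2 + 2 * b * u * v + c * v ^ 2 - (a - b ^ 2 / c) * u ^ 2 = c * (v + b / c * u) ^ 2 := by
    field_simp; ring
  have h3 : 0 ≤ c * (v + b / c * u) ^ 2 := by positivity
  linarith [h1, h2, h3]

/-- The converse direction (sharpness): if `κu² ≤ au² + 2buv + cv²` for all `u, v` and `0 < c`, then `κ ≤ a − b²/c` (test vector `(u,v) = (c, −b)`). -/
theorem le_schur_of_sq_mul_le_quadForm {a b c κ : ℝ} (hc : 0 < c)
    (h : ∀ u v : ℝ, κ * u ^ 2 ≤ a * u ^ 2 + 2 * b * u * v + c * v ^ 2) : κ ≤ a - b ^ 2 / c := by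
  have h1 := h c (-b)
  have h2 : a * c ^ 2 + 2 * b * c * -b + c * (-b) ^ 2 = (a - b ^ 2 / c) * c ^ 2 := by
    field_simp; ring
  rw [h2] at h1
  exact le_of_mul_le_mul_right h1 (by positivity)

/-- **DEGENERATE DIRECTION**: `c = 0` forces `b = 0` for a floor to exist, and then `κ ≤ a` suffices: `κu² ≤ au² + 2·0·uv + 0·v²`. -/
theorem sq_mul_le_quadForm_of_le {a κ u v : ℝ} (hκ : κ ≤ a) :
    κ * u ^ 2 ≤ a * u ^ 2 + 2 * 0 * u * v + 0 * v ^ 2 := by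
  nlinarith [sq_nonneg u]

end Summit.HubbardSuperconductivity.HubbardSuperconductivity.Theorems.C4a

end
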